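import Mathlib
import Summits.Ventures.PercRepro2.Defs
import Summits.Ventures.PercRepro2.Graph
import Summits.Ventures.PercRepro2.OneColourSwitch
import Summits.Ventures.PercRepro2.RegionHubSign
import Summits.Ventures.PercRepro2.SideSwitch
import Summits.Ventures.PercRepro2.M9NoPocketDefs
import Summits.Ventures.PercRepro2.M9NoPocketWorldD
import Summits.Ventures.PercRepro2.M9SubcubeHarris
import Summits.Ventures.PercRepro2.M9ClusterFibreHarris

/-!
# The exploration fibre of a `K`-only point of a unit (blind cell PercRepro2, p3 g39,
2026-08-29; `proofs/P3-POCKETRK.md` §5″ Step 3 and §9 K5, part 1)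

For a colouring `ω₀` with no `W`-side vertex in `G − d` (`∀ x ∈ M₂(G − d), x = r ∨ x = s`:
every block of `G − d` on the `Y`-side — the `K`-only points of a unit without free blocks)
let `U := C_Y(d; ω₀) ∪ K₂(G − d) ∪ M₂(G − d)` — the `Y`-cluster of `d` in `G` together with
the sided vertices of `G − d` and `r, s` — and let `R` be the edges not touching `U`: the
edges inside the outside of the unit away from the cluster of `d`.  The sub-cube
`F(ω₀) = {ω : ω = ω₀ off R}` is the EXPLORATION FIBRE of `ω₀`.

Every edge from a vertex outside `U` into `U` is `W` at `ω₀` (`edge_into_U_closed`), so on the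
fibre a `Y`-path from a vertex outside `U` never enters `U` and is made of `R`-edges; the flip
of the `R`-edges turns it into a `W`-path (`conn_compl_flipR_of_conn`).  Hence the flip
condition `Σ_F 1[p ~_Y q] ≤ Σ_F 1[p ~_W q]` for `p ∉ U` (`sum_unitFibre_connY_le_connW`) and,
by the sub-cube Harris of `M9SubcubeHarris`, **`Σ_{ω ∈ F(ω₀) ∩ A} σ_pq(ω) ≤ 0` for every lower
set `A` of colourings** (`sum_unitFibre_sigma_pq_of_isLowerSet_nonpos`) — the fibre Harris of
`proofs/P3-POCKETRK.md` §5″ Step 3 with the block coordinates pinned.  The fibre data: on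
`F(ω₀)` the clusters of the vertices of `U` — in particular the cluster of `d` and the
`Y`-worlds of `{r, s}` in `G` and in `G − d` — are those of `ω₀`
(`cluster_subset_U`, `cluster_eq_on_unitFibre`, `K2_endsD_eq_on_unitFibre`,
`M2_endsD_eq_on_unitFibre`, `K2_eq_on_unitFibre`; no `W`-side is stated as
`∀ x ∈ M₂(G − d), x = r ∨ x = s`, the `RepD` form, so that no `Fintype V` instance enters the
sums — lesson (N17) of `seats/P3-G38-SUMMARY.md`).  Own work; std axioms.
-/

namespace Summit.Ventures.PercRepro2

namespace NoPocket

open Finset Classical OneColourSwitch SideSwitch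

variable {V : Type*} {E : Type*}

section Pointwise

variable {ends : E → Sym2 V} {r s d : V} {ω₀ : Config E}

/-- **Every edge from a vertex outside `U` into `U` is `W`** at a colouring without a `W`-side
in `G − d`: an open edge into the cluster of `d` would put its other endpoint into the cluster,
an open edge into the `Y`-world of `G − d` would put it into that world, and the `W`-world of
`G − d` is `{r, s}`, whose open edges lead into the `Y`-world. -/
lemma edge_into_U_closed (hdr : d ≠ r) (hds : d ≠ s) (hB : ∀ x ∈ M2 (endsD ends d) r s ω₀, x = r ∨ x = s)
    {e : E} {x y : V} (hxy : ends e = s(x, y))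
    (hx : x ∉ cluster ends ω₀ d ∪ K2 (endsD ends d) r s ω₀ ∪ M2 (endsD ends d) r s ω₀)
    (hy : y ∈ cluster ends ω₀ d ∪ K2 (endsD ends d) r s ω₀ ∪ M2 (endsD ends d) r s ω₀) :
    ω₀ e = false := by
  simp only [Set.mem_union, not_or] at hx
  obtain ⟨⟨hxC, hxK⟩, _⟩ := hx
  cases he : ω₀ e
  · rfl
  · exfalso
    have hxd : x ≠ d := fun h => hxC (h ▸ mem_cluster_self ends ω₀ d)
    -- an open edge from `x` to a vertex of `K₂(G − d)` puts `x` into `K₂(G − d)`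
    have hK : ∀ z, ends e = s(x, z) → z ∈ K2 (endsD ends d) r s ω₀ → False := by
      intro z hxz hz
      have hzd : z ≠ d := fun h => not_mem_K2_endsD hdr hds ω₀ (h ▸ hz)
      have hde : d ∉ ends e := notMem_of_ends_ne hxz hxd hzd
      exact hxK (mem_K2_of_open hz he (by rw [endsD_of_notMem hde, hxz, Sym2.eq_swap]))
    rcases hy with (hyC | hyK) | hyM
    · exact hxC (conn_trans hyC (conn_of_openAdj ⟨e, he, by rw [hxy, Sym2.eq_swap]⟩))
    · exact hK y hxy hyK
    · -- `y ∈ M₂(G − d)`: `y = r` or `y = s` since the `W`-side is empty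
      rcases hB y hyM with rfl | rfl
      · exact hK y hxy (r_mem_K2 y s ω₀)
      · exact hK y hxy (s_mem_K2 r y ω₀)

/-- The cluster of a vertex of `U` lies in `U`: `U` is closed under open edges. -/
lemma cluster_subset_U (hdr : d ≠ r) (hds : d ≠ s) (hB : ∀ x ∈ M2 (endsD ends d) r s ω₀, x = r ∨ x = s)
    {z : V} (hz : z ∈ cluster ends ω₀ d ∪ K2 (endsD ends d) r s ω₀ ∪ M2 (endsD ends d) r s ω₀) :
    cluster ends ω₀ z ⊆
      cluster ends ω₀ d ∪ K2 (endsD ends d) r s ω₀ ∪ M2 (endsD ends d) r s ω₀ := by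
  intro y hy
  refine mem_of_conn_of_closed (ends := ends) (ω := ω₀) ?_ hz hy
  intro a ha b hab
  obtain ⟨_, e, he, hends⟩ := openGraph_adj.1 hab
  by_contra hb
  have := edge_into_U_closed hdr hds hB (by rw [hends, Sym2.eq_swap]) hb ha
  rw [this] at he
  exact Bool.false_ne_true he

/-- On the fibre of `ω₀` — the colourings agreeing with `ω₀` on the edges touching `U` — the
cluster of every vertex of `U` is that of `ω₀` (the domain Markov property). -/
lemma cluster_eq_on_unitFibre (hdr : d ≠ r) (hds : d ≠ s) (hB : ∀ x ∈ M2 (endsD ends d) r s ω₀, x = r ∨ x = s)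
    {ω : Config E}
    (hω : ∀ e ∈ touches ends (cluster ends ω₀ d ∪ K2 (endsD ends d) r s ω₀ ∪
      M2 (endsD ends d) r s ω₀), ω e = ω₀ e)
    {z : V} (hz : z ∈ cluster ends ω₀ d ∪ K2 (endsD ends d) r s ω₀ ∪ M2 (endsD ends d) r s ω₀) :
    cluster ends ω z = cluster ends ω₀ z := by
  refine cluster_eq_of_eqOn_touches (fun e he => (hω e ?_).symm) rfl
  obtain ⟨a, ha, b, hab⟩ := he
  exact ⟨a, cluster_subset_U hdr hds hB hz ha, b, hab⟩

/-- On the fibre of `ω₀` the cluster of `d` is that of `ω₀`. -/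
lemma cluster_d_eq_on_unitFibre (hdr : d ≠ r) (hds : d ≠ s)
    (hB : ∀ x ∈ M2 (endsD ends d) r s ω₀, x = r ∨ x = s) {ω : Config E}
    (hω : ∀ e ∈ touches ends (cluster ends ω₀ d ∪ K2 (endsD ends d) r s ω₀ ∪
      M2 (endsD ends d) r s ω₀), ω e = ω₀ e) :
    cluster ends ω d = cluster ends ω₀ d :=
  cluster_eq_on_unitFibre hdr hds hB hω (Or.inl (Or.inl (mem_cluster_self ends ω₀ d)))

/-- On the fibre of `ω₀` the `Y`-world of `{r, s}` in `G` is that of `ω₀`. -/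
lemma K2_eq_on_unitFibre (hdr : d ≠ r) (hds : d ≠ s) (hB : ∀ x ∈ M2 (endsD ends d) r s ω₀, x = r ∨ x = s)
    {ω : Config E}
    (hω : ∀ e ∈ touches ends (cluster ends ω₀ d ∪ K2 (endsD ends d) r s ω₀ ∪
      M2 (endsD ends d) r s ω₀), ω e = ω₀ e) :
    K2 ends r s ω = K2 ends r s ω₀ := by
  have hr := cluster_eq_on_unitFibre hdr hds hB hω (z := r) (Or.inl (Or.inr (r_mem_K2 r s ω₀)))
  have hs := cluster_eq_on_unitFibre hdr hds hB hω (z := s) (Or.inl (Or.inr (s_mem_K2 r s ω₀)))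
  ext x
  simp only [mem_K2_iff]
  rw [← mem_cluster, ← mem_cluster, ← mem_cluster, ← mem_cluster, hr, hs]

/-- The worlds of `{r, s}` in `G − d` are determined by the edges touching them (in `G`):
the domain Markov property for `K₂(G − d)`. -/
lemma K2_endsD_eq_of_eqOn_touches (hdr : d ≠ r) (hds : d ≠ s) {ω ω' : Config E}
    (h : ∀ e ∈ touches ends (K2 (endsD ends d) r s ω'), ω e = ω' e) :
    K2 (endsD ends d) r s ω = K2 (endsD ends d) r s ω' := by
  have key : ∀ z, z ∈ K2 (endsD ends d) r s ω' →
      cluster (endsD ends d) ω z = cluster (endsD ends d) ω' z := by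
    intro z hz
    refine cluster_eq_of_eqOn_touches (fun e he => (h e ?_).symm) rfl
    obtain ⟨a, ha, b, hab⟩ := he
    have had : a ≠ d := by
      rintro rfl
      exact not_mem_K2_endsD hdr hds ω' (by
        rcases mem_K2_iff.1 hz with hc | hc
        · exact mem_K2_iff.2 (Or.inl (conn_trans hc ha))
        · exact mem_K2_iff.2 (Or.inr (conn_trans hc ha)))
    have hde : d ∉ ends e := by
      intro hde
      rw [endsD_of_mem hde, Sym2.eq_iff] at hab
      rcases hab with ⟨h1, _⟩ | ⟨_, h1⟩ <;> exact had h1.symm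
    refine ⟨a, ?_, b, by rw [← endsD_of_notMem hde, hab]⟩
    rcases mem_K2_iff.1 hz with hc | hc
    · exact mem_K2_iff.2 (Or.inl (conn_trans hc ha))
    · exact mem_K2_iff.2 (Or.inr (conn_trans hc ha))
  have hr := key r (r_mem_K2 r s ω')
  have hs := key s (s_mem_K2 r s ω')
  ext x
  simp only [mem_K2_iff]
  rw [← mem_cluster, ← mem_cluster, ← mem_cluster, ← mem_cluster, hr, hs]

/-- On the fibre of `ω₀` the `Y`-world of `{r, s}` in `G − d` is that of `ω₀`. -/
lemma K2_endsD_eq_on_unitFibre (hdr : d ≠ r) (hds : d ≠ s) {ω : Config E}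
    (hω : ∀ e ∈ touches ends (cluster ends ω₀ d ∪ K2 (endsD ends d) r s ω₀ ∪
      M2 (endsD ends d) r s ω₀), ω e = ω₀ e) :
    K2 (endsD ends d) r s ω = K2 (endsD ends d) r s ω₀ :=
  K2_endsD_eq_of_eqOn_touches hdr hds fun e ⟨a, ha, b, hab⟩ =>
    hω e ⟨a, Or.inl (Or.inr ha), b, hab⟩

/-- On the fibre of `ω₀` the `W`-world of `{r, s}` in `G − d` is that of `ω₀`. -/
lemma M2_endsD_eq_on_unitFibre (hdr : d ≠ r) (hds : d ≠ s) {ω : Config E}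
    (hω : ∀ e ∈ touches ends (cluster ends ω₀ d ∪ K2 (endsD ends d) r s ω₀ ∪
      M2 (endsD ends d) r s ω₀), ω e = ω₀ e) :
    M2 (endsD ends d) r s ω = M2 (endsD ends d) r s ω₀ := by
  rw [← K2_compl, ← K2_compl]
  refine K2_endsD_eq_of_eqOn_touches hdr hds fun e ⟨a, ha, b, hab⟩ => ?_
  have := hω e ⟨a, Or.inr (by rw [← K2_compl]; exact ha), b, hab⟩
  simp only [OneColourSwitch.compl, this]

/-- On the fibre of `ω₀` the `W`-side of `G − d` stays empty. -/
lemma M2_endsD_subset_on_unitFibre (hdr : d ≠ r) (hds : d ≠ s)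
    (hB : ∀ x ∈ M2 (endsD ends d) r s ω₀, x = r ∨ x = s) {ω : Config E}
    (hω : ∀ e ∈ touches ends (cluster ends ω₀ d ∪ K2 (endsD ends d) r s ω₀ ∪
      M2 (endsD ends d) r s ω₀), ω e = ω₀ e) :
    ∀ x ∈ M2 (endsD ends d) r s ω, x = r ∨ x = s := by
  rw [M2_endsD_eq_on_unitFibre hdr hds hω]
  exact hB

/-- **On the fibre, a `Y`-path from a vertex outside `U` never enters `U` and is made of
`R`-edges**: after the flip of the `R`-edges it is a `W`-path. -/
lemma conn_compl_flipR_of_conn (hdr : d ≠ r) (hds : d ≠ s)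
    (hB : ∀ x ∈ M2 (endsD ends d) r s ω₀, x = r ∨ x = s) {ω : Config E}
    (hω : ∀ e ∈ touches ends (cluster ends ω₀ d ∪ K2 (endsD ends d) r s ω₀ ∪
      M2 (endsD ends d) r s ω₀), ω e = ω₀ e)
    {x y : V} (hx : x ∉ cluster ends ω₀ d ∪ K2 (endsD ends d) r s ω₀ ∪ M2 (endsD ends d) r s ω₀)
    (h : Conn ends ω x y) :
    Conn ends (OneColourSwitch.compl (fun e => if e ∈ touches ends (cluster ends ω₀ d ∪
      K2 (endsD ends d) r s ω₀ ∪ M2 (endsD ends d) r s ω₀) then ω e else !ω e)) x y := by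
  set U := cluster ends ω₀ d ∪ K2 (endsD ends d) r s ω₀ ∪ M2 (endsD ends d) r s ω₀ with hU
  have key : y ∈ {z | z ∉ U ∧ Conn ends (OneColourSwitch.compl
      (fun e => if e ∈ touches ends U then ω e else !ω e)) x z} := by
    refine mem_of_conn_of_closed (ends := ends) (ω := ω) ?_ ⟨hx, conn_refl _ _ _⟩ h
    rintro z ⟨hzU, hzc⟩ w hzw
    obtain ⟨_, e, he, hends⟩ := openGraph_adj.1 hzw
    have hwU : w ∉ U := by
      intro hw
      have hfe : ω e = ω₀ e := hω e (mem_touches_of_ends hends (Or.inr hw))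
      have := edge_into_U_closed hdr hds hB hends hzU hw
      rw [hfe, this] at he
      exact Bool.false_ne_true he
    have hnt : e ∉ touches ends U := not_mem_touches_of_ends hends hzU hwU
    have he' : OneColourSwitch.compl (fun e => if e ∈ touches ends U then ω e else !ω e) e =
        true := by
      simp [OneColourSwitch.compl, hnt, he]
    exact ⟨hwU, conn_trans hzc (conn_of_openAdj ⟨e, he', hends⟩)⟩
  exact key.2

end Pointwise

section Sum

variable [Fintype E] [DecidableEq E] {ends : E → Sym2 V} {p q r s d : V} {ω₀ : Config E}

/-- **The flip condition on the exploration fibre of a unit**: for `p ∉ U`,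
`Σ_{F(ω₀)} 1[p ~_Y q] ≤ Σ_{F(ω₀)} 1[p ~_W q]`. -/
theorem sum_unitFibre_connY_le_connW (hdr : d ≠ r) (hds : d ≠ s)
    (hB : ∀ x ∈ M2 (endsD ends d) r s ω₀, x = r ∨ x = s)
    (hp : p ∉ cluster ends ω₀ d ∪ K2 (endsD ends d) r s ω₀ ∪ M2 (endsD ends d) r s ω₀) :
    (∑ ω ∈ univ.filter (fun ω : Config E =>
        ∀ e ∉ univ.filter (fun e => e ∉ touches ends (cluster ends ω₀ d ∪
          K2 (endsD ends d) r s ω₀ ∪ M2 (endsD ends d) r s ω₀)), ω e = ω₀ e),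
      if Conn ends ω p q then (1 : ℚ) else 0) ≤
    ∑ ω ∈ univ.filter (fun ω : Config E =>
        ∀ e ∉ univ.filter (fun e => e ∉ touches ends (cluster ends ω₀ d ∪
          K2 (endsD ends d) r s ω₀ ∪ M2 (endsD ends d) r s ω₀)), ω e = ω₀ e),
      if Conn ends (OneColourSwitch.compl ω) p q then (1 : ℚ) else 0 := by
  set U := cluster ends ω₀ d ∪ K2 (endsD ends d) r s ω₀ ∪ M2 (endsD ends d) r s ω₀ with hU
  set F := univ.filter (fun ω : Config E =>
    ∀ e ∉ univ.filter (fun e => e ∉ touches ends U), ω e = ω₀ e) with hF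
  -- reindex the right-hand side by the involution «flip the free edges»
  have hre : (∑ ω ∈ F, if Conn ends (OneColourSwitch.compl ω) p q then (1 : ℚ) else 0) =
      ∑ ω ∈ F, if Conn ends (OneColourSwitch.compl
        (fun e => if e ∈ touches ends U then ω e else !ω e)) p q then (1 : ℚ) else 0 := by
    refine (Finset.sum_nbij' (fun ω : Config E => fun e => if e ∈ touches ends U then ω e else !ω e)
      (fun ω : Config E => fun e => if e ∈ touches ends U then ω e else !ω e)
      ?_ ?_ ?_ ?_ ?_).symm
    · intro ω hω; exact flipOff_mem_fibre hω
    · intro ω hω; exact flipOff_mem_fibre hω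
    · intro ω _; exact flipOff_flipOff U ω
    · intro ω _; exact flipOff_flipOff U ω
    · intro ω _; rfl
  rw [hre]
  refine Finset.sum_le_sum fun ω hω => ?_
  by_cases hc : Conn ends ω p q
  · rw [if_pos hc]
    have hω' : ∀ e ∈ touches ends U, ω e = ω₀ e := by
      simp only [hF, Finset.mem_filter, Finset.mem_univ, true_and, not_not] at hω
      exact hω
    rw [if_pos (conn_compl_flipR_of_conn hdr hds hB hω' hp hc)]
  · rw [if_neg hc]
    split_ifs <;> norm_num

/-- **The exploration-fibre Harris of a unit**: for a colouring `ω₀` without a `W`-side in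
`G − d`, every lower set `A` of colourings and every `p ∉ U(ω₀)`,
`Σ_{ω ∈ F(ω₀) ∩ A} σ_pq(ω) ≤ 0` — the fibre Harris of `proofs/P3-POCKETRK.md` §5″ Step 3
with the block coordinates and the cluster of `d` pinned. -/
theorem sum_unitFibre_sigma_pq_of_isLowerSet_nonpos (hdr : d ≠ r) (hds : d ≠ s)
    (hB : ∀ x ∈ M2 (endsD ends d) r s ω₀, x = r ∨ x = s)
    (hp : p ∉ cluster ends ω₀ d ∪ K2 (endsD ends d) r s ω₀ ∪ M2 (endsD ends d) r s ω₀)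
    {A : Set (Config E)} (hA : IsLowerSet A) :
    (∑ ω ∈ univ.filter (fun ω : Config E =>
        ∀ e ∉ univ.filter (fun e => e ∉ touches ends (cluster ends ω₀ d ∪
          K2 (endsD ends d) r s ω₀ ∪ M2 (endsD ends d) r s ω₀)), ω e = ω₀ e),
      if ω ∈ A then sigma ends ω p q else 0) ≤ 0 :=
  sum_subcube_sigma_pq_of_isLowerSet_nonpos
    (univ.filter (fun e => e ∉ touches ends (cluster ends ω₀ d ∪
      K2 (endsD ends d) r s ω₀ ∪ M2 (endsD ends d) r s ω₀))) ω₀ hA p q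
    (sum_unitFibre_connY_le_connW hdr hds hB hp)

end Sum

end NoPocket

end Summit.Ventures.PercRepro2
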